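import Literature.AlgebraicGeometry.HodgeTheory.WeilTypeFourfoldTimesCMCurveSquaredBlockData
import Literature.AlgebraicGeometry.HodgeTheory.WeilTypeTiedBlockedHodgeGroupOfLie
import Literature.AlgebraicGeometry.HodgeTheory.AbelianLowDimensionNonSimpleFourfoldsFivefoldRows
import Literature.AlgebraicGeometry.VanGeemen1994.WeilTypeEndFieldOfRankTwo
import Literature.AlgebraicGeometry.HodgeTheory.RankOneCentreTimesCMCurveProductSpan
import Literature.NumberTheory.DiophantineGeometry.AVIsogenyTateFreeHomProofs
import HarnessLib

/-!
# The block data of the tied socket at `A = Y₄ × (E_K × E_K)`, II: `Φ` central (`hφC`), `End(A)` scalar on the `Y`-block (`hEndU`) and stable on the `E`-blocks (`hEndT`); the packaged Lie-to-group passage `hG` of TABLE X row 20 (Moonen–Zarhin 1999 §5; Milne 1999 §1; Mumford §19)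

Family `hodge`, layer `Literature/AlgebraicGeometry/HodgeTheory`, namespace `Literature.AlgebraicGeometry.HodgeTheory`.
THEOREMS ONLY: no definition, no named fact, no `sorry` (D-0026). Cell `pub-hodgeav-hg6` (req-37 (A) Q2b), seat eng-2 g8,
brick **E1b** (lead g4 2026-08-29T10:09:06Z GO; E1a = `WeilTypeFourfoldTimesCMCurveSquaredBlockData`). HONEST FRAMING:
HC ∕ HC_AV (stmt-1333) ∕ HC_CM (stmt-3052) ∕ H2 NOT proved and do not occur. The Lie hypothesis `hSU` of the socket (the
row's Lie theorem, eng-5's `hodgeLieC_fourfold_prod_cmCurveSq_of_threeOne`) stays a HYPOTHESIS of the package.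

WHAT. Member data: `Y` SIMPLE with `dim E < dim Y` (row 20: `dim Y = 4`), `finrank_ℚ End⁰(Y) = 2` (`End⁰(Y) = K`),
`φ_Y ≫ φ_Y = −d`; `E` with `dim E = 1`, `χ ≫ χ = −d` (and, for the general-`E` lemmas of §0–§1, `finrank_ℚ End⁰(E) = 2`
as a binder `hEE`; in the package §2 it is DERIVED from `dim E = 1`, `χ ≫ χ = −d` by the tree's CM-curve rank lemma
`finrank_endAlgebra_eq_two_of_cmCurve` ∘ `isOfCMType_of_cmCurve` — lead g4's ruling 11:04:51Z); the diagonal `Φ` (`Φ ≫ pr₁ = pr₁ ≫ φ_Y`, `Φ ≫ pr₂ = pr₂ ≫ Φ₂`,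
`Φ₂ ≫ prᵢ = prᵢ ≫ χ`).
* §0 `CMCurveSqFourfold.comp_comm_of_finrank_endAlgebra_eq_two` (endomorphisms of `A` commute with `φ` when
  `End⁰(A) = ℚ + ℚφ`: Mumford §19 Thm. 3 injectivity `End → End⁰` + van Geemen 6.11), `…_prod_hom_ext_left` (maps out of a
  product are determined on the two inclusions), **`…_eq_blockDiag_of_isSimple`** (every endomorphism of `Y × (E × E)` is
  `diag(a, b)`: `Hom(Y, E) = Hom(E, Y) = 0` for `Y` simple of larger dimension), `…_comm_blockDiag_cmCurveSq` (every
  endomorphism of `E × E` commutes with `diag(χ, χ)` — the four corners commute with `χ`).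
* §1 **`…_comp_comm_diagonal`** = hφC (`θ ≫ Φ = Φ ≫ θ` for every `θ`), **`…_exists_scalar_untied`** = hEndU
  (`θ^* = x + y·i√d` on `W_{i√d}(φ_E) = pr₁^* W_K(Y)`), `…_mem_eigenspace_blockDiag₂_iff` (Künneth for `E × E`),
  **`…_apply_mem_iSup_tied`** = hEndT (`θ^* = pr₂^* b^* ι₂^*` on `pr₂^* H¹(E × E)` and `b^*` commutes with `Φ₂^*`).
* (Cross-reference, not used: the rank-level companion of §0's block-diagonality is eng-4 g9's
  `AbelianVariety.finrank_endAlgebra_prod_of_isSimple_of_dim_ne` in `Motives/AbelianVarietyEndAlgebraProdOfHomEqZero`.)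
* §2 **`CMCurveSqFourfold.hG_of_hodgeLieC`** — THE PACKAGE: the S3-T socket
  `IsWeilType.mem_hodgeGroupOne_of_mem_unitaryCentralizerGroup_tied_of_hodgeLieC` fed with E1a + §1: from the member
  data, `hW : IsWeilType (Y.prod (E.prod E)) Φ 3 d`, a polarization `ψ` with the row's Lie theorem `hSU` (all-endomorphisms
  antecedent) and Milne's `h`-data, EVERY `u ∈ S(A)(h)(ℂ)` with `det(u | W_K) = 1` lies in `Hg(A)(ℂ)|_{H¹}` — the `hG` of
  L18b `TableX.WeilERows.census_weilType_detOne_general_prod_prod` VERBATIM.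

## References
* [MoonenZarhin1999LowDim] B. Moonen, Yu. Zarhin, Math. Ann. 315 (1999), §2 (2.1), (2.3), §5 (5.2)–(5.3), (5.11).
* [Milne1999LefschetzClasses] J. S. Milne, Duke Math. J. 96 (1999), §1 pp. 642–644, §4 p. 659.
* [MumfordAV1970] D. Mumford, Abelian Varieties (1970), §19 Thm. 3 and Cor. 2 (p. 174).
* [vanGeemen1994HodgeAV] B. van Geemen, LNM 1594 (1994), 6.9, Thm. 6.11.
* [VoisinHodgeI2002] C. Voisin, Hodge Theory I (2002), §11.3.3 Thm. 11.38.
-/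

noncomputable section

open scoped TensorProduct
open CategoryTheory Module

namespace Literature.AlgebraicGeometry.HodgeTheory

open Literature.AlgebraicTopology.SingularHomology
open Literature.AlgebraicGeometry.Motives (AbelianVariety bettiCohomology ofRatClassBaseChange IsSmoothProjective HodgeTensorFacts)
open Literature.AlgebraicGeometry.Motives.HodgeStructure
open Literature.AlgebraicGeometry.Motives.AbelianVariety (fst snd prodLift prod_hom_ext prodLift_fst prodLift_snd endAlgebra)
open Literature.AlgebraicGeometry.Milne1999.CMTypeProducts (blockDiag blockDiag_comp)
open Literature.AlgebraicGeometry.VanGeemen1994 (pullbackOne hodgeGroupOne hodgeClassSpan detOnEigenspace)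
open Literature.AlgebraicGeometry.Milne1999
open Literature.AlgebraicGeometry.ComplexMultiplication (bettiCohomology_map_comp_hom bettiCohomology_map_add_one
  bettiCohomology_map_id_hom)
open HOneProduct
open Literature.AlgebraicGeometry.HodgeTheory.AbelianLowDimension.NonSimpleFourfolds (hom_eq_zero_of_isSimple_of_dim_lt)
open Literature.AlgebraicGeometry.HodgeTheory.AbelianLowDimension.LowDimOfMarkman (hom_eq_zero_of_isSimple_of_lt_dim)

/-! ### §0 Endomorphisms of `Y × (E × E)` are block-diagonal; corners commute with `φ_Y`, `χ` -/

section Blocks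

variable {A B : AbelianVariety ℂ}

/-- **`End⁰(A) = ℚ + ℚφ` ⟹ every endomorphism commutes with `φ`** (at the morphism level: `End(A) → End⁰(A)` is injective in
characteristic zero, Mumford §19 Thm. 3, and `End⁰(A)` is commutative, van Geemen 6.11). [cite: MumfordAV1970, §19 Thm. 3]
[cite: vanGeemen1994HodgeAV, Thm. 6.11] -/
theorem CMCurveSqFourfold.comp_comm_of_finrank_endAlgebra_eq_two (hA0 : 0 < A.dim) {d : ℕ} (hd : 0 < d) {φ : A ⟶ A}
    (hφ : φ ≫ φ = -(d • 𝟙 A)) (hE2 : Module.finrank ℚ A.endAlgebra = 2) (a b : A ⟶ A) : a ≫ b = b ≫ a := by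
  have h : endAlgebra.of A (End.of (a ≫ b)) = endAlgebra.of A (End.of (b ≫ a)) := by
    change endAlgebra.of A (End.of b * End.of a) = endAlgebra.of A (End.of a * End.of b)
    rw [map_mul, map_mul, VanGeemen1994.endAlgebra_mul_comm_of_finrank_endAlgebra_eq_two hA0 hd hφ hE2]
  exact AbelianVariety.endAlgebra.of_injective_of_charZero h

/-- Maps OUT of `A × B` are determined by their restrictions to the two inclusions (`𝟙 = pr₁ ≫ ι₁ + pr₂ ≫ ι₂`).
[cite: Milne1999LefschetzClasses, §1 p. 642] -/
theorem CMCurveSqFourfold.prod_hom_ext_left {C : AbelianVariety ℂ} {f g : A.prod B ⟶ C}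
    (h₁ : inlHom A B ≫ f = inlHom A B ≫ g) (h₂ : inrHom A B ≫ f = inrHom A B ≫ g) : f = g := by
  rw [← Category.id_comp f, ← Category.id_comp g, ← fst_inlHom_add_snd_inrHom, Preadditive.add_comp, Preadditive.add_comp,
    Category.assoc, Category.assoc, Category.assoc, Category.assoc, h₁, h₂]

/-- `ι₁ ≫ diag(a, b) = a ≫ ι₁`. [cite: Milne1999LefschetzClasses, §1 p. 642] -/
theorem CMCurveSqFourfold.inlHom_blockDiag (a : A ⟶ A) (b : B ⟶ B) : inlHom A B ≫ blockDiag A B a b = a ≫ inlHom A B := by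
  rw [blockDiag_eq, Preadditive.comp_add, ← Category.assoc, inlHom_fst, Category.id_comp, ← Category.assoc, inlHom_snd,
    Limits.zero_comp, add_zero]

/-- `ι₂ ≫ diag(a, b) = b ≫ ι₂`. [cite: Milne1999LefschetzClasses, §1 p. 642] -/
theorem CMCurveSqFourfold.inrHom_blockDiag (a : A ⟶ A) (b : B ⟶ B) : inrHom A B ≫ blockDiag A B a b = b ≫ inrHom A B := by
  rw [blockDiag_eq, Preadditive.comp_add, ← Category.assoc, inrHom_fst, Limits.zero_comp, zero_add, ← Category.assoc,
    inrHom_snd, Category.id_comp]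

/-- An endomorphism of `A × B` whose mixed corners vanish IS `diag(ι₁ θ pr₁, ι₂ θ pr₂)`. [cite: Milne1999LefschetzClasses, §1 p. 642]
[cite: MumfordAV1970, §19 Thm. 3] -/
theorem CMCurveSqFourfold.eq_blockDiag_of_corners (θ : A.prod B ⟶ A.prod B) (h12 : inlHom A B ≫ θ ≫ snd A B = 0)
    (h21 : inrHom A B ≫ θ ≫ fst A B = 0) :
    θ = blockDiag A B (inlHom A B ≫ θ ≫ fst A B) (inrHom A B ≫ θ ≫ snd A B) := by
  refine CMCurveSqFourfold.prod_hom_ext_left ?_ ?_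
  · rw [CMCurveSqFourfold.inlHom_blockDiag]
    refine prod_hom_ext ?_ ?_
    · rw [Category.assoc, Category.assoc, Category.assoc, inlHom_fst, Category.comp_id]
    · rw [Category.assoc, h12, Category.assoc, Category.assoc, inlHom_snd, Limits.comp_zero, Limits.comp_zero]
  · rw [CMCurveSqFourfold.inrHom_blockDiag]
    refine prod_hom_ext ?_ ?_
    · rw [Category.assoc, h21, Category.assoc, Category.assoc, inrHom_fst, Limits.comp_zero, Limits.comp_zero]
    · rw [Category.assoc, Category.assoc, Category.assoc, inrHom_snd, Category.comp_id]

variable {Y E : AbelianVariety ℂ}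

/-- **Every endomorphism of `Y × (E × E)` is block-diagonal `diag(a, b)`** when `Y` is SIMPLE and `dim E < dim Y`
(`Hom(Y, E) = 0 = Hom(E, Y)`, so the mixed corners vanish). [cite: MoonenZarhin1999LowDim, §5 (5.2)] [cite: MumfordAV1970, §19 Thm. 3] -/
theorem CMCurveSqFourfold.eq_blockDiag_of_isSimple (hYs : Y.IsSimple) (hEY : E.dim < Y.dim)
    (θ : Y.prod (E.prod E) ⟶ Y.prod (E.prod E)) :
    θ = blockDiag Y (E.prod E) (inlHom Y (E.prod E) ≫ θ ≫ fst Y (E.prod E)) (inrHom Y (E.prod E) ≫ θ ≫ snd Y (E.prod E)) := by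
  refine CMCurveSqFourfold.eq_blockDiag_of_corners θ ?_ ?_
  · -- `Y → E × E` vanishes componentwise
    refine prod_hom_ext ?_ ?_
    · rw [Limits.zero_comp, Category.assoc, Category.assoc]
      exact hom_eq_zero_of_isSimple_of_lt_dim hYs hEY _
    · rw [Limits.zero_comp, Category.assoc, Category.assoc]
      exact hom_eq_zero_of_isSimple_of_lt_dim hYs hEY _
  · -- `E × E → Y` vanishes on both inclusions
    refine CMCurveSqFourfold.prod_hom_ext_left ?_ ?_
    · rw [Limits.comp_zero]
      exact hom_eq_zero_of_isSimple_of_dim_lt hYs hEY _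
    · rw [Limits.comp_zero]
      exact hom_eq_zero_of_isSimple_of_dim_lt hYs hEY _

/-- **Every endomorphism of `E × E` commutes with the diagonal `diag(χ, χ)`** when `finrank_ℚ End⁰(E) = 2` and
`χ ≫ χ = −d`: its four corners commute with `χ`. [cite: MumfordAV1970, §19 Thm. 3] [cite: vanGeemen1994HodgeAV, Thm. 6.11] -/
theorem CMCurveSqFourfold.comm_blockDiag_cmCurveSq (hE0 : 0 < E.dim) {d : ℕ} (hd : 0 < d) {χ : E ⟶ E}
    (hχ : χ ≫ χ = -(d • 𝟙 E)) (hEE : Module.finrank ℚ E.endAlgebra = 2) (b : E.prod E ⟶ E.prod E) :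
    b ≫ blockDiag E E χ χ = blockDiag E E χ χ ≫ b := by
  have hc := CMCurveSqFourfold.comp_comm_of_finrank_endAlgebra_eq_two hE0 hd hχ hEE
  have key : ∀ (ι : E ⟶ E.prod E) (π : E.prod E ⟶ E), ι ≫ blockDiag E E χ χ = χ ≫ ι →
      blockDiag E E χ χ ≫ π = π ≫ χ → ι ≫ b ≫ blockDiag E E χ χ ≫ π = ι ≫ blockDiag E E χ χ ≫ b ≫ π := by
    intro ι π hι hπ
    rw [hπ, ← Category.assoc ι (blockDiag E E χ χ), hι, Category.assoc]
    have h := hc (ι ≫ b ≫ π) χ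
    simpa only [Category.assoc] using h
  refine CMCurveSqFourfold.prod_hom_ext_left (prod_hom_ext ?_ ?_) (prod_hom_ext ?_ ?_)
  · simp only [Category.assoc]
    exact key _ _ (CMCurveSqFourfold.inlHom_blockDiag χ χ) (CMCurveSqFourfold.blockDiag_comp_fst χ χ)
  · simp only [Category.assoc]
    exact key _ _ (CMCurveSqFourfold.inlHom_blockDiag χ χ) (CMCurveSqFourfold.blockDiag_comp_snd χ χ)
  · simp only [Category.assoc]
    exact key _ _ (CMCurveSqFourfold.inrHom_blockDiag χ χ) (CMCurveSqFourfold.blockDiag_comp_fst χ χ)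
  · simp only [Category.assoc]
    exact key _ _ (CMCurveSqFourfold.inrHom_blockDiag χ χ) (CMCurveSqFourfold.blockDiag_comp_snd χ χ)

end Blocks

/-! ### §1 `Φ` central; `End(A)` scalar on the `Y`-block and stable on the tied `E`-blocks -/

section Central

variable {Y E : AbelianVariety ℂ} {d : ℕ} {φY : Y ⟶ Y} {χ : E ⟶ E}

/-- **hφC — the diagonal `K`-action `Φ = diag(φ_Y, diag(χ, χ))` is CENTRAL in `End(Y × (E × E))`**: every `θ` is
`diag(a, b)` (`Y` simple, `dim E < dim Y`), `a` commutes with `φ_Y` (`End⁰(Y) = ℚ + ℚφ_Y`) and `b` with `diag(χ, χ)`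
(`End⁰(E) = ℚ + ℚχ`). [cite: MoonenZarhin1999LowDim, §5 (5.2)] [cite: MumfordAV1970, §19 Thm. 3] [cite: vanGeemen1994HodgeAV, Thm. 6.11] -/
theorem CMCurveSqFourfold.comp_comm_diagonal (hYs : Y.IsSimple) (hEY : E.dim < Y.dim) (h0Y : 0 < Y.dim) (hd : 0 < d)
    (hφY : φY ≫ φY = -(d • 𝟙 Y)) (hE2 : Module.finrank ℚ Y.endAlgebra = 2) (hE0 : 0 < E.dim) (hχ : χ ≫ χ = -(d • 𝟙 E))
    (hEE : Module.finrank ℚ E.endAlgebra = 2) {Φ₂ : E.prod E ⟶ E.prod E} (hΦ₂a : Φ₂ ≫ fst E E = fst E E ≫ χ)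
    (hΦ₂b : Φ₂ ≫ snd E E = snd E E ≫ χ) {Φ : Y.prod (E.prod E) ⟶ Y.prod (E.prod E)}
    (hΦ₁ : Φ ≫ fst Y (E.prod E) = fst Y (E.prod E) ≫ φY) (hΦ₂ : Φ ≫ snd Y (E.prod E) = snd Y (E.prod E) ≫ Φ₂) :
    ∀ θ : Y.prod (E.prod E) ⟶ Y.prod (E.prod E), θ ≫ Φ = Φ ≫ θ := by
  intro θ
  have hθ := CMCurveSqFourfold.eq_blockDiag_of_isSimple hYs hEY θ
  have hΦ := CMCurveSqFourfold.eq_blockDiag₃ hΦ₂a hΦ₂b hΦ₁ hΦ₂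
  have ha := CMCurveSqFourfold.comp_comm_of_finrank_endAlgebra_eq_two h0Y hd hφY hE2
    (inlHom Y (E.prod E) ≫ θ ≫ fst Y (E.prod E)) φY
  have hb := CMCurveSqFourfold.comm_blockDiag_cmCurveSq hE0 hd hχ hEE (inrHom Y (E.prod E) ≫ θ ≫ snd Y (E.prod E))
  rw [hΦ]
  conv_lhs => rw [hθ, blockDiag_comp, ha, hb]
  conv_rhs => rw [hθ, blockDiag_comp]

/-- `ℚ`-scalars act on `V_ℂ` as complex scalars. [folklore] -/
private theorem ratCast_smul₉ {V : Type*} [AddCommGroup V] [Module ℚ V] (q : ℚ) (z : ℂ ⊗[ℚ] V) :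
    (q : ℂ) • z = q • z := by
  rw [← algebraMap_smul ℂ q z, eq_ratCast]

/-- **hEndU — `End(A)` acts on the untied block `W_{i√d}(φ_E) = pr₁^* W_K(Y)` by SCALARS**: `θ = diag(a, b)` and
`a^* = x + y φ_Y^*` on `H¹(Y)` (`End_Hdg(H¹Y) = ℚ + ℚφ_Y^*`, Riemann), so `θ^* = x + y·i√d` there.
[cite: MoonenZarhin1999LowDim, §2 (2.1) and §5 (5.2)] [cite: vanGeemen1994HodgeAV, Thm. 6.11] -/
theorem CMCurveSqFourfold.exists_scalar_untied (hYs : Y.IsSimple) (hEY : E.dim < Y.dim) (h0Y : 0 < Y.dim) (hd : 0 < d)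
    (hφY : φY ≫ φY = -(d • 𝟙 Y)) (hE2 : Module.finrank ℚ Y.endAlgebra = 2) (hχ : χ ≫ χ = -(d • 𝟙 E)) :
    ∀ (θ : Y.prod (E.prod E) ⟶ Y.prod (E.prod E)) (k : Fin 3), k ∉ ({1, 2} : Finset (Fin 3)) → ∃ s : ℂ,
      ∀ x ∈ Module.End.eigenspace (((bettiCohomology.map (blockDiag Y (E.prod E) φY
        (blockDiag E E (2 • χ) (3 • χ))).hom.hom.hom 1).hom).baseChange ℂ) (((k : ℕ) + 1 : ℂ) * (Complex.I * (Real.sqrt d : ℂ))),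
        ((bettiCohomology.map θ.hom.hom.hom 1).hom).baseChange ℂ x = s • x := by
  intro θ k hk
  have hk0 : k = 0 := by
    fin_cases k
    · rfl
    · exact absurd (by decide) hk
    · exact absurd (by decide) hk
  subst hk0
  have hHD : exists_isReal_hodgeModel := exists_isReal_hodgeModel_holds
  have hI : hodgePQ_independent_of_hodgeModel := hodgePQ_independent_of_hodgeModel_holds
  -- `θ = diag(a, b)` and `a^* = x + y φ_Y^*`
  set a := inlHom Y (E.prod E) ≫ θ ≫ fst Y (E.prod E) with hadef
  set b := inrHom Y (E.prod E) ≫ θ ≫ snd Y (E.prod E) with hbdef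
  have hθ : θ = blockDiag Y (E.prod E) a b := CMCurveSqFourfold.eq_blockDiag_of_isSimple hYs hEY θ
  obtain ⟨x₀, y₀, hxy⟩ := exists_eq_smul_one_add_smul_bettiMapHom hHD hI hd hφY hE2 h0Y _ (pullback_mem_endAlg hHD hI a)
  refine ⟨(x₀ : ℂ) + (y₀ : ℂ) * (Complex.I * (Real.sqrt d : ℂ)), fun x hx => ?_⟩
  obtain ⟨hY, h1, h2⟩ := (CMCurveSqFourfold.mem_eigenspace_colour_iff φY χ hd hφY hχ 0 x).1 hx
  replace hY : (pullInl Y (E.prod E)).baseChange ℂ x ∈ Module.End.eigenspace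
      (((bettiCohomology.map φY.hom.hom.hom 1).hom).baseChange ℂ) (Complex.I * (Real.sqrt d : ℂ)) := by
    rcases hY with ⟨-, h⟩ | ⟨h, -⟩
    · exact h
    · exact absurd rfl h
  replace h1 : (pullInl E E).baseChange ℂ ((pullInr Y (E.prod E)).baseChange ℂ x) = 0 := by
    rcases h1 with ⟨h, -⟩ | ⟨-, h⟩
    · exact absurd h (by decide)
    · exact h
  replace h2 : (pullInr E E).baseChange ℂ ((pullInr Y (E.prod E)).baseChange ℂ x) = 0 := by
    rcases h2 with ⟨h, -⟩ | ⟨-, h⟩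
    · exact absurd h (by decide)
    · exact h
  -- `ι_P^* x = 0` and `x = pr₁^* ι_Y^* x`
  have hP : (pullInr Y (E.prod E)).baseChange ℂ x = 0 := by
    rw [← pullFst_pullInl_add_baseChange (A := E) (B := E) ((pullInr Y (E.prod E)).baseChange ℂ x), h1, h2, map_zero,
      map_zero, add_zero]
  have hx_eq : x = (pullFst Y (E.prod E)).baseChange ℂ ((pullInl Y (E.prod E)).baseChange ℂ x) := by
    conv_lhs => rw [← pullFst_pullInl_add_baseChange (A := Y) (B := E.prod E) x, hP, map_zero, add_zero]
  -- `θ^* x = pr₁^* (a^* (ι_Y^* x))`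
  have hθx : ((bettiCohomology.map θ.hom.hom.hom 1).hom).baseChange ℂ x =
      (pullFst Y (E.prod E)).baseChange ℂ ((((bettiCohomology.map a.hom.hom.hom 1).hom).baseChange ℂ)
        ((pullInl Y (E.prod E)).baseChange ℂ x)) := by
    have h := pull_blockDiag (A := Y) (B := E.prod E) a b
    change (bettiCohomology.map (blockDiag Y (E.prod E) a b).hom.hom.hom 1).hom = _ at h
    conv_lhs => rw [hθ, h]
    simp only [LinearMap.baseChange_add, LinearMap.baseChange_comp, LinearMap.add_apply, LinearMap.comp_apply]
    rw [hP, map_zero, map_zero, add_zero]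
  -- `a^* = x₀ + y₀ φ_Y^*` acts on `W_K(Y)` by `x₀ + y₀ i√d`
  have haW : (((bettiCohomology.map a.hom.hom.hom 1).hom).baseChange ℂ) ((pullInl Y (E.prod E)).baseChange ℂ x) =
      ((x₀ : ℂ) + (y₀ : ℂ) * (Complex.I * (Real.sqrt d : ℂ))) • (pullInl Y (E.prod E)).baseChange ℂ x := by
    rw [hxy, LinearMap.baseChange_add, LinearMap.baseChange_smul, LinearMap.baseChange_smul, LinearMap.add_apply,
      LinearMap.smul_apply, LinearMap.smul_apply, LinearMap.baseChange_one, Module.End.one_apply,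
      Module.End.mem_eigenspace_iff.1 hY, ← ratCast_smul₉, ← ratCast_smul₉, smul_smul, ← add_smul]
  rw [hθx, haW, map_smul, ← hx_eq]

/-- Eigenvectors of `diag(g₁, g₂)^*_ℂ` on `H¹(E × E) ⊗ ℂ` componentwise (Künneth). [cite: VoisinHodgeI2002, §11.3.3 Thm. 11.38] -/
theorem CMCurveSqFourfold.mem_eigenspace_blockDiag₂_iff (g₁ g₂ : E ⟶ E) (c : ℂ) (v : ℂ ⊗[ℚ] bettiCohomology (E.prod E).X 1) :
    v ∈ Module.End.eigenspace (((bettiCohomology.map (blockDiag E E g₁ g₂).hom.hom.hom 1).hom).baseChange ℂ) c ↔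
      (pullInl E E).baseChange ℂ v ∈ Module.End.eigenspace (((bettiCohomology.map g₁.hom.hom.hom 1).hom).baseChange ℂ) c ∧
        (pullInr E E).baseChange ℂ v ∈ Module.End.eigenspace (((bettiCohomology.map g₂.hom.hom.hom 1).hom).baseChange ℂ) c := by
  have hT : ∀ w, ((bettiCohomology.map (blockDiag E E g₁ g₂).hom.hom.hom 1).hom).baseChange ℂ w =
      (pullFst E E).baseChange ℂ ((((bettiCohomology.map g₁.hom.hom.hom 1).hom).baseChange ℂ) ((pullInl E E).baseChange ℂ w)) +
      (pullSnd E E).baseChange ℂ ((((bettiCohomology.map g₂.hom.hom.hom 1).hom).baseChange ℂ) ((pullInr E E).baseChange ℂ w)) := by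
    intro w
    have h := pull_blockDiag (A := E) (B := E) g₁ g₂
    change (bettiCohomology.map (blockDiag E E g₁ g₂).hom.hom.hom 1).hom = _ at h
    rw [h]
    simp only [LinearMap.baseChange_add, LinearMap.baseChange_comp, LinearMap.add_apply, LinearMap.comp_apply]
  simp only [Module.End.mem_eigenspace_iff]
  constructor
  · intro hv
    rw [hT] at hv
    have h1 := congrArg ((pullInl E E).baseChange ℂ) hv
    have h2 := congrArg ((pullInr E E).baseChange ℂ) hv
    simp only [map_add, map_smul, pullInl_pullFst_baseChange, pullInl_pullSnd_baseChange, pullInr_pullSnd_baseChange,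
      pullInr_pullFst_baseChange, add_zero, zero_add] at h1 h2
    exact ⟨h1, h2⟩
  · rintro ⟨h1, h2⟩
    have hv : v = (pullFst E E).baseChange ℂ ((pullInl E E).baseChange ℂ v) +
        (pullSnd E E).baseChange ℂ ((pullInr E E).baseChange ℂ v) := by rw [pullFst_pullInl_add_baseChange]
    conv_lhs => rw [hT, h1, h2]
    conv_rhs => rw [hv]
    rw [map_smul, map_smul, smul_add]

/-- **hEndT — `End(A)` preserves the span of the tied blocks** `W_{2i√d}(φ_E) ⊔ W_{3i√d}(φ_E) = pr₂^* W_K(diag(χ, χ))`: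
`θ = diag(a, b)` acts there as `pr₂^* b^* ι₂^*`, and `b` commutes with `diag(χ, χ)` (`End⁰(E) = ℚ + ℚχ`).
[cite: MoonenZarhin1999LowDim, §5 (5.2)–(5.3)] [cite: MumfordAV1970, §19 Thm. 3] -/
theorem CMCurveSqFourfold.apply_mem_iSup_tied (hYs : Y.IsSimple) (hEY : E.dim < Y.dim) (hd : 0 < d)
    (hφY : φY ≫ φY = -(d • 𝟙 Y)) (hE0 : 0 < E.dim) (hχ : χ ≫ χ = -(d • 𝟙 E)) (hEE : Module.finrank ℚ E.endAlgebra = 2) :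
    ∀ θ : Y.prod (E.prod E) ⟶ Y.prod (E.prod E),
      ∀ x ∈ ⨆ k ∈ ({1, 2} : Finset (Fin 3)), Module.End.eigenspace (((bettiCohomology.map (blockDiag Y (E.prod E) φY
        (blockDiag E E (2 • χ) (3 • χ))).hom.hom.hom 1).hom).baseChange ℂ) (((k : ℕ) + 1 : ℂ) * (Complex.I * (Real.sqrt d : ℂ))),
        ((bettiCohomology.map θ.hom.hom.hom 1).hom).baseChange ℂ x ∈
          ⨆ k ∈ ({1, 2} : Finset (Fin 3)), Module.End.eigenspace (((bettiCohomology.map (blockDiag Y (E.prod E) φY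
            (blockDiag E E (2 • χ) (3 • χ))).hom.hom.hom 1).hom).baseChange ℂ)
              (((k : ℕ) + 1 : ℂ) * (Complex.I * (Real.sqrt d : ℂ))) := by
  intro θ x hx
  -- the tied span is `W₁ ⊔ W₂`
  rw [Finset.iSup_insert, Finset.iSup_singleton] at hx ⊢
  -- `θ = diag(a, b)`, `b` commutes with `diag(χ, χ)`
  set a := inlHom Y (E.prod E) ≫ θ ≫ fst Y (E.prod E) with hadef
  set b := inrHom Y (E.prod E) ≫ θ ≫ snd Y (E.prod E) with hbdef
  have hθ : θ = blockDiag Y (E.prod E) a b := CMCurveSqFourfold.eq_blockDiag_of_isSimple hYs hEY θ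
  have hbD := CMCurveSqFourfold.comm_blockDiag_cmCurveSq hE0 hd hχ hEE b
  have hbDQ : ((bettiCohomology.map b.hom.hom.hom 1).hom).baseChange ℂ *
      ((bettiCohomology.map (blockDiag E E χ χ).hom.hom.hom 1).hom).baseChange ℂ =
      ((bettiCohomology.map (blockDiag E E χ χ).hom.hom.hom 1).hom).baseChange ℂ *
        ((bettiCohomology.map b.hom.hom.hom 1).hom).baseChange ℂ := by
    rw [← LinearMap.baseChange_mul, ← LinearMap.baseChange_mul, bettiMapHom_comm_of_comm hbD]
  -- `θ^*` on a vector of the form `pr₂^* v`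
  have hθP : ∀ v : ℂ ⊗[ℚ] bettiCohomology (E.prod E).X 1,
      ((bettiCohomology.map θ.hom.hom.hom 1).hom).baseChange ℂ ((pullSnd Y (E.prod E)).baseChange ℂ v) =
        (pullSnd Y (E.prod E)).baseChange ℂ (((bettiCohomology.map b.hom.hom.hom 1).hom).baseChange ℂ v) := by
    intro v
    have h := pull_blockDiag (A := Y) (B := E.prod E) a b
    change (bettiCohomology.map (blockDiag Y (E.prod E) a b).hom.hom.hom 1).hom = _ at h
    conv_lhs => rw [hθ, h]
    simp only [LinearMap.baseChange_add, LinearMap.baseChange_comp, LinearMap.add_apply, LinearMap.comp_apply]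
    rw [pullInl_pullSnd_baseChange, map_zero, map_zero, zero_add, pullInr_pullSnd_baseChange]
  -- each tied block is carried into `W₁ ⊔ W₂`
  have hcarry : ∀ (w : ℂ ⊗[ℚ] bettiCohomology E.X 1) (b₀ : Bool),
      w ∈ Module.End.eigenspace (((bettiCohomology.map χ.hom.hom.hom 1).hom).baseChange ℂ) (Complex.I * (Real.sqrt d : ℂ)) →
      ((bettiCohomology.map θ.hom.hom.hom 1).hom).baseChange ℂ ((pullSnd Y (E.prod E)).baseChange ℂ
        ((if b₀ then pullFst E E else pullSnd E E).baseChange ℂ w)) ∈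
      Module.End.eigenspace (((bettiCohomology.map (blockDiag Y (E.prod E) φY
          (blockDiag E E (2 • χ) (3 • χ))).hom.hom.hom 1).hom).baseChange ℂ)
          ((((1 : Fin 3) : ℕ) + 1 : ℂ) * (Complex.I * (Real.sqrt d : ℂ))) ⊔
        Module.End.eigenspace (((bettiCohomology.map (blockDiag Y (E.prod E) φY
          (blockDiag E E (2 • χ) (3 • χ))).hom.hom.hom 1).hom).baseChange ℂ)
          ((((2 : Fin 3) : ℕ) + 1 : ℂ) * (Complex.I * (Real.sqrt d : ℂ))) := by
    intro w b₀ hw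
    rw [hθP]
    set v := ((bettiCohomology.map b.hom.hom.hom 1).hom).baseChange ℂ
      ((if b₀ then pullFst E E else pullSnd E E).baseChange ℂ w) with hvdef
    -- `v ∈ W_K(diag(χ, χ))`, so its two components lie in `W_K(E)`
    have hvD : v ∈ Module.End.eigenspace (((bettiCohomology.map (blockDiag E E χ χ).hom.hom.hom 1).hom).baseChange ℂ)
        (Complex.I * (Real.sqrt d : ℂ)) := by
      refine UnitaryTheta.apply_mem_eigenspace_of_commute hbDQ ?_
      rw [CMCurveSqFourfold.mem_eigenspace_blockDiag₂_iff]
      cases b₀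
      · simp only [Bool.false_eq_true, if_false]
        rw [pullInl_pullSnd_baseChange, pullInr_pullSnd_baseChange]
        exact ⟨Submodule.zero_mem _, hw⟩
      · simp only [if_true]
        rw [pullInl_pullFst_baseChange, pullInr_pullFst_baseChange]
        exact ⟨hw, Submodule.zero_mem _⟩
    obtain ⟨hv1, hv2⟩ := (CMCurveSqFourfold.mem_eigenspace_blockDiag₂_iff χ χ _ v).1 hvD
    have hsplit : (pullSnd Y (E.prod E)).baseChange ℂ v =
        (pullSnd Y (E.prod E)).baseChange ℂ ((pullFst E E).baseChange ℂ ((pullInl E E).baseChange ℂ v)) +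
        (pullSnd Y (E.prod E)).baseChange ℂ ((pullSnd E E).baseChange ℂ ((pullInr E E).baseChange ℂ v)) := by
      rw [← map_add, pullFst_pullInl_add_baseChange]
    rw [hsplit]
    refine Submodule.add_mem _ (Submodule.mem_sup_left ?_) (Submodule.mem_sup_right ?_)
    · rw [CMCurveSqFourfold.eigenspace_tied₁_eq_map hd hφY hχ]
      exact ⟨_, hv1, rfl⟩
    · rw [CMCurveSqFourfold.eigenspace_tied₂_eq_map hd hφY hχ]
      exact ⟨_, hv2, rfl⟩
  -- decompose `x ∈ W₁ ⊔ W₂`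
  obtain ⟨x₁, hx₁, x₂, hx₂, rfl⟩ := Submodule.mem_sup.1 hx
  rw [map_add]
  refine Submodule.add_mem _ ?_ ?_
  · rw [CMCurveSqFourfold.eigenspace_tied₁_eq_map hd hφY hχ] at hx₁
    obtain ⟨w, hw, rfl⟩ := hx₁
    rw [LinearMap.comp_apply]
    exact hcarry w true hw
  · rw [CMCurveSqFourfold.eigenspace_tied₂_eq_map hd hφY hχ] at hx₂
    obtain ⟨w, hw, rfl⟩ := hx₂
    rw [LinearMap.comp_apply]
    exact hcarry w false hw

end Central

/-! ### §2 THE PACKAGE: L18b's `hG` at `A = Y₄ × E_K²` from the row's Lie theorem -/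

section Package

variable {Y E : AbelianVariety ℂ} {d : ℕ}

open scoped Classical in
/-- **THE LIE-TO-GROUP PASSAGE OF TABLE X ROW 20 WITH ALL MEMBER DATA DISCHARGED.** For `Y` of dimension `4` with
`finrank_ℚ End⁰(Y) = 2` and `φ_Y ≫ φ_Y = −d` (so `Y` is SIMPLE, van Geemen 6.9), `E` of dimension `1` with `χ ≫ χ = −d`
(so `finrank_ℚ End⁰(E) = 2`: a CM curve — derived, `finrank_endAlgebra_eq_two_of_cmCurve` ∘ `isOfCMType_of_cmCurve`),
the diagonal `Φ` (through `Φ₂ = diag(χ, χ)`) of Weil type `(3, d)` on `A = Y × (E × E)`, a polarization `ψ` of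
`H¹(A(ℂ); ℚ)` with the DISPLAYED row-20 Lie theorem `hSU` (all-endomorphisms antecedent; = eng-5's
`hodgeLieC_fourfold_prod_cmCurveSq_of_threeOne`), and `h ∈ B¹(A) ⊗ ℂ` with `Q_h` non-degenerate and `Φ^*` a `d`-similitude:
EVERY `u ∈ S(A)(h)(ℂ)` with `det(u | W_K) = 1` lies in `Hg(A)(ℂ)|_{H¹}` — the hypothesis `hG` of L18b
`TableX.WeilERows.census_weilType_detOne_general_prod_prod` VERBATIM. (The tied socket S3-T
`IsWeilType.mem_hodgeGroupOne_of_mem_unitaryCentralizerGroup_tied_of_hodgeLieC` fed with the data of E1a and §1.)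
NOT proved here: `hSU`, HC for any row. [cite: MoonenZarhin1999LowDim, §5 (5.2)–(5.3), (5.11)]
[cite: Milne1999LefschetzClasses, §1 p. 644 and §4 p. 659] [cite: Deligne1982HodgeCycles, I §3 Prop. 3.4 and 3.6] -/
theorem CMCurveSqFourfold.hG_of_hodgeLieC [HodgeTensorFacts.{0, 0}] (hY4 : Y.dim = 4) (φY : Y ⟶ Y)
    (hd : 0 < d) (hφY : φY ≫ φY = -(d • 𝟙 Y)) (hE2 : Module.finrank ℚ Y.endAlgebra = 2) (hE1 : E.dim = 1) (χ : E ⟶ E)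
    (hχ : χ ≫ χ = -(d • 𝟙 E)) (Φ₂ : E.prod E ⟶ E.prod E)
    (hΦ₂a : Φ₂ ≫ fst E E = fst E E ≫ χ) (hΦ₂b : Φ₂ ≫ snd E E = snd E E ≫ χ)
    (Φ : Y.prod (E.prod E) ⟶ Y.prod (E.prod E)) (hΦ₁ : Φ ≫ fst Y (E.prod E) = fst Y (E.prod E) ≫ φY)
    (hΦ₂ : Φ ≫ snd Y (E.prod E) = snd Y (E.prod E) ≫ Φ₂) (hW : IsWeilType (Y.prod (E.prod E)) Φ 3 d)
    (ψ : (BettiUniverse.hodge exists_isReal_hodgeModel_holds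
      (AbelianVariety.isSmoothProjective_holds (A := Y.prod (E.prod E))) 1).Polarization)
    (hSU : ∀ (Yop : Module.End ℂ (ℂ ⊗[ℚ] bettiCohomology (Y.prod (E.prod E)).X 1))
      (hall : ∀ θ : Y.prod (E.prod E) ⟶ Y.prod (E.prod E), Yop * ((bettiCohomology.map θ.hom.hom.hom 1).hom).baseChange ℂ =
        ((bettiCohomology.map θ.hom.hom.hom 1).hom).baseChange ℂ * Yop),
      (∀ x y, ψ.form.baseChange ℂ (Yop x) y + ψ.form.baseChange ℂ x (Yop y) = 0) →
      LinearMap.trace ℂ _ (Yop.restrict fun x (hx : x ∈ Module.End.eigenspace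
          (((bettiCohomology.map Φ.hom.hom.hom 1).hom).baseChange ℂ) (Complex.I * (Real.sqrt d : ℂ))) =>
        UnitaryTheta.apply_mem_eigenspace_of_commute (hall Φ) hx) = 0 →
      Yop ∈ (BettiUniverse.hodge exists_isReal_hodgeModel_holds
        (AbelianVariety.isSmoothProjective_holds (A := Y.prod (E.prod E))) 1).hodgeLieC)
    {h : complexBetti (Y.prod (E.prod E)).X 2} (hh : h ∈ hodgeClassSpan (Y.prod (E.prod E)).dim (Y.prod (E.prod E)).X 1)
    (hnd : ∀ x : complexBetti (Y.prod (E.prod E)).X 1,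
      (∀ y, Motives.polarizationPairingOne (Y.prod (E.prod E)).X h ((Y.prod (E.prod E)).dim - 1) x y = 0) → x = 0)
    (hφQ : ∀ x y, Motives.polarizationPairingOne (Y.prod (E.prod E)).X h ((Y.prod (E.prod E)).dim - 1)
      (pullbackOne (Y.prod (E.prod E)) Φ x) (pullbackOne (Y.prod (E.prod E)) Φ y) =
      (d : ℂ) • Motives.polarizationPairingOne (Y.prod (E.prod E)).X h ((Y.prod (E.prod E)).dim - 1) x y) :
    ∀ (u : complexBetti (Y.prod (E.prod E)).X 1 ≃ₗ[ℂ] complexBetti (Y.prod (E.prod E)).X 1)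
      (hu : u ∈ unitaryCentralizerGroup (Y.prod (E.prod E)) h),
      detOnEigenspace u (pullbackOne (Y.prod (E.prod E)) Φ) (fun x ↦ (mem_centralizerGroup_iff.1 hu.1) Φ x)
        (Complex.I * (Real.sqrt d : ℂ)) = 1 → u ∈ hodgeGroupOne (Y.prod (E.prod E)).dim (Y.prod (E.prod E)).X := by
  intro u hu hdet
  have hEY : E.dim < Y.dim := by omega
  have h0Y : 0 < Y.dim := by omega
  have hE0 : 0 < E.dim := by omega
  -- `Y` is simple: `End⁰(Y)` is a field (van Geemen 6.9, Mumford §19 Cor. 2)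
  have hYs : Y.IsSimple := VanGeemen1994.isSimple_of_finrank_endAlgebra_eq_two h0Y hd hφY hE2
  -- `E` is a CM curve: `finrank_ℚ End⁰(E) = 2` (`χ ≫ χ = −d` on a curve)
  have hEE : Module.finrank ℚ E.endAlgebra = 2 := finrank_endAlgebra_eq_two_of_cmCurve hE1 (isOfCMType_of_cmCurve hE1 hd hχ)
  exact hW.mem_hodgeGroupOne_of_mem_unitaryCentralizerGroup_tied_of_hodgeLieC
    (CMCurveSqFourfold.comp_comm_diagonal hYs hEY h0Y hd hφY hE2 hE0 hχ hEE hΦ₂a hΦ₂b hΦ₁ hΦ₂)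
    (blockDiag Y (E.prod E) φY (blockDiag E E (2 • χ) (3 • χ)))
    (fun k : Fin 3 => ((k : ℕ) + 1 : ℂ) * (Complex.I * (Real.sqrt d : ℂ))) (CMCurveSqFourfold.colour_injective hd)
    (CMCurveSqFourfold.eigenspace_le_weil hd hφY hχ hΦ₂a hΦ₂b hΦ₁ hΦ₂)
    (CMCurveSqFourfold.weil_le_iSup_eigenspace hd hφY hχ hΦ₂a hΦ₂b hΦ₁ hΦ₂) ({1, 2} : Finset (Fin 3))
    (CMCurveSqFourfold.finrank_eigenspace_tied_eq_one hd hφY hE1 hχ) (k₀ := 0) (by decide)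
    (CMCurveSqFourfold.eigenspace_untied_ne_bot hd h0Y hφY hχ) (CMCurveSqFourfold.exists_tie hd hφY hE1 hχ)
    (CMCurveSqFourfold.exists_scalar_untied hYs hEY h0Y hd hφY hE2 hχ)
    (CMCurveSqFourfold.apply_mem_iSup_tied hYs hEY hd hφY hE0 hχ hEE) ψ hSU hh hnd hφQ u hu hdet

end Package

end Literature.AlgebraicGeometry.HodgeTheory

end
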